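import Mathlib

/-!
# Bricks for the `GL₂(𝔽₅)`-lifting route (T5′): invariants, simplicity of `𝔰𝔩₂`, and the
# non-splitting of `SL₂(ℤ/5^{m+1}) → SL₂(ℤ/5^m)` for every `m ≥ 1`

Kernel checks of three group-theoretic inputs of the `GL₂(𝔽₅)`-residual variant of Manoharmayum's
lifting theorem ([M] = Manoharmayum, Proc. AMS 143 (2015), arXiv:1304.1196; the variant = ARM-P
audit r07 S7 ADDENDUM-1 §C (C3), 2026-08-27), the paper route that discharges Kato's hypothesis
(12.5.2) / Skinner–Urban's lattice clause for the NON-RATIONAL members of the ordinary `Λ`-fibre at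
`p = 5` (target T-S7r07-1 `FibreLatticeInput 5`) on the cite-level facts
`Fouquet2024.padicValRat_bsd_rank_zero_of_ordinaryFibre{_ellipticShape,}{,_levelNotOneModP}` consumed
by the K8-t′ fibre roads `…TameLowerFouquetFibreRoad{,Level}` for item 19618 `TameLowerIntrinsicNonCM`
(open core of 19981 `TameLowerHalfRankZero`). Companion of
`…TameLowerFibreAdjointH1Five` (`H¹(GL₂(𝔽₅), 𝔤𝔩₂/𝔰𝔩₂) = 0`, the input of (C3)(d) at `m = 1`).

* `eq_scalar_of_commute_transvections` — over ANY commutative ring, a `2 × 2` matrix commuting with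
  the elementary transvections `u = (1 1; 0 1)`, `v = (1 0; 1 1)` is scalar
  (`M₂(A)^{SL₂} = A·1`; used in (C3)(f) and in the level-2 non-example of the owner's note §3c(ii)).
* `traceless_submodule_eq_bot_or_top` — [M] Lemma 3.3 for `n = 2` over a field with `2 ≠ 0`: a
  linear subspace of `𝔰𝔩₂` stable under `Ad(u)`, `Ad(v)` is `0` or `𝔰𝔩₂` (input of (C3)(c),(f):
  `𝔰𝔩₂(𝔽₅)` is a simple `𝔽₅[SL₂(𝔽₅)]`-module; the hypothesis here is weaker — stability under the
  two generators only).
* `transvection_lift_pow_five` — over a commutative ring with `π² = 0`, `5π = 0`, every lift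
  `u + πD` of `u` satisfies `(u + πD)⁵ = u⁵` (the order computation inside [M] Prop. 3.7, `p = 5`:
  `Σ_{i<5} uⁱDu^{4-i} = 5·(D + 2(eD + De) + 2eDe)`), checked entrywise by `linear_combination` with
  an offline-computed cofactor certificate (HOME/k8t-c2/g14/kit).
* `not_exists_section_SL2` — **[M] Prop. 3.7 at `p = 5`, `k = 𝔽₅`, ALL levels**: for every
  `m ≥ 1` the reduction `SL₂(ℤ/5^{m+1}) → SL₂(ℤ/5^m)` has no homomorphic section (input of (C3)(e),
  an infinite family — not a finite check): a section would send the transvection `ū` (order `5^m`)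
  to a lift whose `5^m`-th power is `(1 5^m; 0 1) ≠ 1`.

Nothing here is specific to elliptic curves and nothing here proves anything about items
19618/19981 (Kato's Conj. 12.10 lower inclusion at an additive potentially supersingular prime —
open); with the companion file, every input of (T5′) that is a statement about ONE finite level or
about the tower's non-splitting is now kernel-checked, and what remains of (T5′) on paper is [M]'s
Artinian induction (Props. 2.2, 3.6, Claim 4.3 run with `Q = S^μ(W_B)`). Mathlib only, no
definitions (pure proof file), route-free.
-/

set_option linter.dupNamespace false

open Matrix

namespace Summit.BirchSwinnertonDyer.BirchSwinnertonDyer.Theorems.GL2F5AdjointBricks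


section invariants

variable {R : Type*} [CommRing R]

/-- **`M₂(R)^{SL₂} = scalars`**: a `2 × 2` matrix over any commutative ring commuting with the two
elementary transvections `(1 1; 0 1)` and `(1 0; 1 1)` is scalar. -/
theorem eq_scalar_of_commute_transvections (X : Matrix (Fin 2) (Fin 2) R)
    (hu : !![1, 1; 0, 1] * X = X * !![1, 1; 0, 1]) (hv : !![1, 0; 1, 1] * X = X * !![1, 0; 1, 1]) :
    X = X 0 0 • (1 : Matrix (Fin 2) (Fin 2) R) := by
  rw [Matrix.eta_fin_two X] at hu hv
  simp only [Matrix.mul_fin_two] at hu hv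
  have e00 := congrFun (congrFun hu 0) 0
  have e01 := congrFun (congrFun hu 0) 1
  have f00 := congrFun (congrFun hv 0) 0
  simp at e00 e01 f00
  -- e00 : X 1 0 = 0 ;  e01 : X 0 1 + X 1 1 = X 0 0 + X 0 1 ;  f00 : X 0 1 = 0
  have h11 : X 1 1 = X 0 0 := by linear_combination e01
  ext i j
  fin_cases i <;> fin_cases j <;> simp [e00, f00, h11]

end invariants

section simple

variable {F : Type*} [Field F]

/-- **Simplicity of the adjoint module `𝔰𝔩₂` ([M] Lemma 3.3, `n = 2`, characteristic `≠ 2`).** Over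
a field with `2 ≠ 0`, a linear subspace of trace-zero `2 × 2` matrices stable under conjugation by
the two elementary transvections `u = (1 1; 0 1)`, `v = (1 0; 1 1)` is `0` or all of `𝔰𝔩₂`. -/
theorem traceless_submodule_eq_bot_or_top (h2 : (2 : F) ≠ 0)
    (N : Submodule F (Matrix (Fin 2) (Fin 2) F)) (htr : ∀ X ∈ N, Matrix.trace X = 0)
    (hu : ∀ X ∈ N, !![1, 1; 0, 1] * X * !![1, -1; 0, 1] ∈ N)
    (hv : ∀ X ∈ N, !![1, 0; 1, 1] * X * !![1, 0; -1, 1] ∈ N) :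
    N = ⊥ ∨ ∀ Y : Matrix (Fin 2) (Fin 2) F, Matrix.trace Y = 0 → Y ∈ N := by
  classical
  by_cases hN : N = ⊥
  · exact Or.inl hN
  right
  obtain ⟨X, hXN, hX0⟩ := (Submodule.ne_bot_iff N).1 hN
  -- `D_u = Ad(u) - 1` and `D_v = Ad(v) - 1` preserve `N`
  have Du_mem : ∀ Y ∈ N, !![1, 1; 0, 1] * Y * !![1, -1; 0, 1] - Y ∈ N :=
    fun Y hY => N.sub_mem (hu Y hY) hY
  have Dv_mem : ∀ Y ∈ N, !![1, 0; 1, 1] * Y * !![1, 0; -1, 1] - Y ∈ N :=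
    fun Y hY => N.sub_mem (hv Y hY) hY
  -- their action on trace-zero matrices
  have Du_formula : ∀ a b c : F, (!![1, 1; 0, 1] * !![a, b; c, -a] * !![1, -1; 0, 1] - !![a, b; c, -a]
      : Matrix (Fin 2) (Fin 2) F) = !![c, -2 * a - c; 0, -c] := by
    intro a b c
    simp only [Matrix.mul_fin_two]
    ext i j
    fin_cases i <;> fin_cases j <;> simp
    all_goals ring
  have Dv_formula : ∀ a b c : F, (!![1, 0; 1, 1] * !![a, b; c, -a] * !![1, 0; -1, 1] - !![a, b; c, -a]
      : Matrix (Fin 2) (Fin 2) F) = !![-b, 0; 2 * a - b, - -b] := by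
    intro a b c
    simp only [Matrix.mul_fin_two]
    ext i j
    fin_cases i <;> fin_cases j <;> simp
    all_goals ring
  -- write `X = (a b; c -a)`
  have hX11 : X 1 1 = -X 0 0 := by
    have h := htr X hXN
    rw [Matrix.trace_fin_two] at h
    linear_combination h
  obtain ⟨a, b, c, rfl⟩ : ∃ a b c : F, X = !![a, b; c, -a] :=
    ⟨X 0 0, X 0 1, X 1 0, by rw [← hX11]; exact Matrix.eta_fin_two X⟩
  -- rescaling inside `N`
  have smul_mem_of : ∀ (t : F) (Y Z : Matrix (Fin 2) (Fin 2) F), t ≠ 0 → t • Y = Z → Z ∈ N → Y ∈ N := by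
    intro t Y Z ht hYZ hZ
    have : Y = t⁻¹ • Z := by rw [← hYZ, smul_smul, inv_mul_cancel₀ ht, one_smul]
    rw [this]
    exact N.smul_mem _ hZ
  have hm2 : (-2 : F) ≠ 0 := neg_ne_zero.mpr h2
  -- (1) from `F' = (0 0; 1 0) ∈ N` get `E = (0 1; 0 0) ∈ N`
  have E_of_F : (!![0, 0; 1, 0] : Matrix (Fin 2) (Fin 2) F) ∈ N →
      (!![0, 1; 0, 0] : Matrix (Fin 2) (Fin 2) F) ∈ N := by
    intro hF
    have h0 : (!![0, 0; 1, 0] : Matrix (Fin 2) (Fin 2) F) = !![0, 0; 1, -0] := by rw [neg_zero]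
    rw [h0] at hF
    have h1 := Du_mem _ hF
    rw [Du_formula] at h1
    -- h1 : (1, -2·0 - 1; 0, -1) ∈ N
    have h1' : (!![1, -1; 0, -1] : Matrix (Fin 2) (Fin 2) F) ∈ N := by
      convert h1 using 1
      ext i j; fin_cases i <;> fin_cases j <;> simp
    have h2 := Du_mem _ h1'
    rw [Du_formula] at h2
    -- h2 : (0, -2·1 - 0; 0, -0) ∈ N
    refine smul_mem_of (-2) _ _ hm2 ?_ h2
    ext i j; fin_cases i <;> fin_cases j <;> simp
  -- (2) from `E ∈ N` get `F' ∈ N` and `H = (1 0; 0 -1) ∈ N`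
  have FH_of_E : (!![0, 1; 0, 0] : Matrix (Fin 2) (Fin 2) F) ∈ N →
      (!![0, 0; 1, 0] : Matrix (Fin 2) (Fin 2) F) ∈ N ∧ (!![1, 0; 0, -1] : Matrix (Fin 2) (Fin 2) F) ∈ N := by
    intro hE
    have h0 : (!![0, 1; 0, 0] : Matrix (Fin 2) (Fin 2) F) = !![0, 1; 0, -0] := by rw [neg_zero]
    rw [h0] at hE
    have h1 := Dv_mem _ hE
    rw [Dv_formula] at h1
    -- h1 : (-1, 0; 2·0 - 1, - -1) ∈ N
    have h1' : (!![-1, 0; -1, - -1] : Matrix (Fin 2) (Fin 2) F) ∈ N := by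
      convert h1 using 1
      ext i j; fin_cases i <;> fin_cases j <;> simp
    have h2 := Dv_mem _ h1'
    rw [Dv_formula] at h2
    -- h2 : (-0, 0; 2·(-1) - 0, - -0) ∈ N
    have hF : (!![0, 0; 1, 0] : Matrix (Fin 2) (Fin 2) F) ∈ N := by
      refine smul_mem_of (-2) _ _ hm2 ?_ h2
      ext i j; fin_cases i <;> fin_cases j <;> simp
    refine ⟨hF, ?_⟩
    -- `H = -(D_v E) - F'`
    have h3 := N.sub_mem (N.neg_mem h1') hF
    convert h3 using 1
    ext i j; fin_cases i <;> fin_cases j <;> simp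
  -- (3) one of `E`, `F'`, `H` lies in `N`
  have hE : (!![0, 1; 0, 0] : Matrix (Fin 2) (Fin 2) F) ∈ N := by
    rcases ne_or_eq c 0 with hc | hc
    · -- `D_u² X = -2c · E`
      have h1 := Du_mem _ hXN
      rw [Du_formula] at h1
      have h2 := Du_mem _ h1
      rw [Du_formula] at h2
      refine smul_mem_of (-2 * c) _ _ (mul_ne_zero hm2 hc) ?_ h2
      ext i j; fin_cases i <;> fin_cases j <;> simp
    subst hc
    rcases ne_or_eq b 0 with hb | hb
    · -- `D_v² X = -2b · F'`
      have h1 := Dv_mem _ hXN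
      rw [Dv_formula] at h1
      have h2 := Dv_mem _ h1
      rw [Dv_formula] at h2
      apply E_of_F
      refine smul_mem_of (-2 * b) _ _ (mul_ne_zero hm2 hb) ?_ h2
      ext i j; fin_cases i <;> fin_cases j <;> simp
    subst hb
    -- `X = a · H` with `a ≠ 0`
    have ha : a ≠ 0 := by
      rintro rfl
      exact hX0 (by ext i j; fin_cases i <;> fin_cases j <;> simp)
    have hH : (!![1, 0; 0, -1] : Matrix (Fin 2) (Fin 2) F) ∈ N := by
      refine smul_mem_of a _ _ ha ?_ hXN
      ext i j; fin_cases i <;> fin_cases j <;> simp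
    -- `D_u H = -2 · E`
    have h1 := Du_mem _ hH
    rw [Du_formula] at h1
    refine smul_mem_of (-2) _ _ hm2 ?_ h1
    ext i j; fin_cases i <;> fin_cases j <;> simp
  obtain ⟨hF, hH⟩ := FH_of_E hE
  -- (4) every trace-zero matrix is a combination of `H`, `E`, `F'`
  intro Y hY
  have hY11 : Y 1 1 = -Y 0 0 := by
    rw [Matrix.trace_fin_two] at hY
    linear_combination hY
  have hYeq : Y = Y 0 0 • !![1, 0; 0, -1] + Y 0 1 • !![0, 1; 0, 0] + Y 1 0 • !![0, 0; 1, 0] := by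
    ext i j; fin_cases i <;> fin_cases j <;> simp [hY11]
  rw [hYeq]
  exact N.add_mem (N.add_mem (N.smul_mem _ hH) (N.smul_mem _ hE)) (N.smul_mem _ hF)

end simple



section transvection

variable {R : Type*} [CommRing R]

/-- Powers of an upper transvection: `(1 t; 0 1)^k = (1 kt; 0 1)`. -/
theorem transvection_pow (t : R) (k : ℕ) :
    (!![1, t; 0, 1] : Matrix (Fin 2) (Fin 2) R) ^ k = !![1, (k : R) * t; 0, 1] := by
  induction k with
  | zero => simp [Matrix.one_fin_two]
  | succ k ih =>
    rw [pow_succ, ih, Matrix.mul_fin_two]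
    ext i j
    fin_cases i <;> fin_cases j <;> simp
    ring

/-- **The order computation behind [M] Prop. 3.7 at `p = 5`.** Over a commutative ring in which
`π² = 0` and `5π = 0` (e.g. `π = 5^m` in `ℤ/5^{m+1}`, `m ≥ 1`), EVERY lift `u + πD` of the
transvection `u = (1 1; 0 1)` has fifth power `u⁵ = (1 5; 0 1)` — because
`Σ_{i<5} uⁱ D u^{4-i} = 5·(D + 2(e D + D e + e D e))` (`u = 1 + e`). -/
theorem transvection_lift_pow_five (π a b c d : R) (h5 : 5 * π = 0) (hπ : π * π = 0) :
    (!![1 + π * a, 1 + π * b; π * c, 1 + π * d] : Matrix (Fin 2) (Fin 2) R) ^ 5 = !![1, 5; 0, 1] := by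
  ext i j
  fin_cases i <;> fin_cases j <;>
    simp [pow_succ, Matrix.mul_apply, Fin.sum_univ_two]
  -- entry (0,0)
  · linear_combination (2 * c + a) * h5 + (10 * c * d + 5 * c ^ 2 + 10 * b * c + 20 * a * c + 10 * a ^ 2 + 5 * π * c * d ^ 2 + 2 * π * c ^ 2 * d + 10 * π * b * c * d + 10 * π * b * c ^ 2 + 10 * π * a * c * d + 3 * π * a * c ^ 2 + 20 * π * a * b * c + 15 * π * a ^ 2 * c + 10 * π * a ^ 3 + π ^ 2 * c * d ^ 3 + 5 * π ^ 2 * b * c * d ^ 2 + 4 * π ^ 2 * b * c ^ 2 * d + 5 * π ^ 2 * b ^ 2 * c ^ 2 + 2 * π ^ 2 * a * c * d ^ 2 + 10 * π ^ 2 * a * b * c * d + 6 * π ^ 2 * a * b * c ^ 2 + 3 * π ^ 2 * a ^ 2 * c * d + 15 * π ^ 2 * a ^ 2 * b * c + 4 * π ^ 2 * a ^ 3 * c + 5 * π ^ 2 * a ^ 4 + π ^ 3 * b * c * d ^ 3 + 2 * π ^ 3 * b ^ 2 * c ^ 2 * d + 2 * π ^ 3 * a * b * c * d ^ 2 + 3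 * π ^ 3 * a * b ^ 2 * c ^ 2 + 3 * π ^ 3 * a ^ 2 * b * c * d + 4 * π ^ 3 * a ^ 3 * b * c + π ^ 3 * a ^ 5) * hπ
  -- entry (0,1)
  · linear_combination (2 * d + 2 * c + b + 2 * a) * h5 + (10 * d ^ 2 + 10 * c * d + c ^ 2 + 10 * b * d + 20 * b * c + 10 * a * d + 10 * a * c + 10 * a * b + 10 * a ^ 2 + 5 * π * d ^ 3 + 3 * π * c * d ^ 2 + 10 * π * b * d ^ 2 + 20 * π * b * c * d + 3 * π * b * c ^ 2 + 10 * π * b ^ 2 * c + 5 * π * a * d ^ 2 + 4 * π * a * c * d + 10 * π * a * b * d + 20 * π * a * b * c + 5 * π * a ^ 2 * d + 3 * π * a ^ 2 * c + 10 * π * a ^ 2 * b + 5 * π * a ^ 3 + π ^ 2 * d ^ 4 + 5 * π ^ 2 * b * d ^ 3 + 6 * π ^ 2 * b * c * d ^ 2 + 10 * π ^ 2 * b ^ 2 * c * d + 3 * π ^ 2 * b ^ 2 * c ^ 2 + π ^ 2 * a * d ^ 3 + 5 * π ^ 2 * a * b * d ^ 2 + 8 * π ^ 2 * a * b * c * d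 + 10 * π ^ 2 * a * b ^ 2 * c + π ^ 2 * a ^ 2 * d ^ 2 + 5 * π ^ 2 * a ^ 2 * b * d + 6 * π ^ 2 * a ^ 2 * b * c + π ^ 2 * a ^ 3 * d + 5 * π ^ 2 * a ^ 3 * b + π ^ 2 * a ^ 4 + π ^ 3 * b * d ^ 4 + 3 * π ^ 3 * b ^ 2 * c * d ^ 2 + π ^ 3 * b ^ 3 * c ^ 2 + π ^ 3 * a * b * d ^ 3 + 4 * π ^ 3 * a * b ^ 2 * c * d + π ^ 3 * a ^ 2 * b * d ^ 2 + 3 * π ^ 3 * a ^ 2 * b ^ 2 * c + π ^ 3 * a ^ 3 * b * d + π ^ 3 * a ^ 4 * b) * hπ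
  -- entry (1,0)
  · linear_combination (c) * h5 + (10 * c * d + 10 * c ^ 2 + 10 * a * c + 10 * π * c * d ^ 2 + 10 * π * c ^ 2 * d + π * c ^ 3 + 10 * π * b * c ^ 2 + 10 * π * a * c * d + 10 * π * a * c ^ 2 + 10 * π * a ^ 2 * c + 5 * π ^ 2 * c * d ^ 3 + 3 * π ^ 2 * c ^ 2 * d ^ 2 + 10 * π ^ 2 * b * c ^ 2 * d + 2 * π ^ 2 * b * c ^ 3 + 5 * π ^ 2 * a * c * d ^ 2 + 4 * π ^ 2 * a * c ^ 2 * d + 10 * π ^ 2 * a * b * c ^ 2 + 5 * π ^ 2 * a ^ 2 * c * d + 3 * π ^ 2 * a ^ 2 * c ^ 2 + 5 * π ^ 2 * a ^ 3 * c + π ^ 3 * c * d ^ 4 + 3 * π ^ 3 * b * c ^ 2 * d ^ 2 + π ^ 3 * b ^ 2 * c ^ 3 + π ^ 3 * a * c * d ^ 3 + 4 * π ^ 3 * a * b * c ^ 2 * d + π ^ 3 * a ^ 2 * c * d ^ 2 + 3 * π ^ 3 * a ^ 2 * b * c ^ 2 + π ^ 3 * a ^ 3 * c * d + π ^ 3 *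 a ^ 4 * c) * hπ
  -- entry (1,1)
  · linear_combination (d + 2 * c) * h5 + (10 * d ^ 2 + 20 * c * d + 5 * c ^ 2 + 10 * b * c + 10 * a * c + 10 * π * d ^ 3 + 15 * π * c * d ^ 2 + 3 * π * c ^ 2 * d + 20 * π * b * c * d + 10 * π * b * c ^ 2 + 10 * π * a * c * d + 2 * π * a * c ^ 2 + 10 * π * a * b * c + 5 * π * a ^ 2 * c + 5 * π ^ 2 * d ^ 4 + 4 * π ^ 2 * c * d ^ 3 + 15 * π ^ 2 * b * c * d ^ 2 + 6 * π ^ 2 * b * c ^ 2 * d + 5 * π ^ 2 * b ^ 2 * c ^ 2 + 3 * π ^ 2 * a * c * d ^ 2 + 10 * π ^ 2 * a * b * c * d + 4 * π ^ 2 * a * b * c ^ 2 + 2 * π ^ 2 * a ^ 2 * c * d + 5 * π ^ 2 * a ^ 2 * b * c + π ^ 2 * a ^ 3 * c + π ^ 3 * d ^ 5 + 4 * π ^ 3 * b * c * d ^ 3 + 3 * π ^ 3 * b ^ 2 * c ^ 2 * d + 3 * π ^ 3 * a * b * c * d ^ 2 + 2 * π ^ 3 * a * b ^ 2 * c ^ 2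 + 2 * π ^ 3 * a ^ 2 * b * c * d + π ^ 3 * a ^ 3 * b * c) * hπ

end transvection

section nonsplit

/-- In `ℤ/5^{m+1}` an element that reduces to `0` in `ℤ/5^m` is a multiple of `5^m`. -/
theorem exists_eq_mul_of_castHom_eq_zero (m : ℕ) (x : ZMod (5 ^ (m + 1)))
    (hx : ZMod.castHom (pow_dvd_pow 5 m.le_succ) (ZMod (5 ^ m)) x = 0) :
    ∃ t : ZMod (5 ^ (m + 1)), x = ((5 ^ m : ℕ) : ZMod (5 ^ (m + 1))) * t := by
  haveI : NeZero (5 ^ (m + 1)) := ⟨pow_ne_zero _ (by norm_num)⟩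
  have hval : ((x.val : ℕ) : ZMod (5 ^ m)) = 0 := by
    rwa [ZMod.castHom_apply, ZMod.cast_eq_val] at hx
  obtain ⟨q, hq⟩ := (ZMod.natCast_eq_zero_iff _ _).1 hval
  refine ⟨q, ?_⟩
  rw [← ZMod.natCast_zmod_val x, hq]
  push_cast
  ring

/-- **Non-splitting of `SL₂(ℤ/5^{m+1}) → SL₂(ℤ/5^m)` for every `m ≥ 1`** ([M] Prop. 3.7 at
`p = 5`, `k = 𝔽₅`, all levels): the reduction map admits no homomorphic section. Proof: a section
`s` sends the transvection `ū = (1 1; 0 1)` (of order `5^m`) to a lift `u + 5^m D`, whose fifth power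
is `u⁵` exactly (`transvection_lift_pow_five` with `π = 5^m`: `π² = 0`, `5π = 0` in `ℤ/5^{m+1}`),
so `s(ū)^{5^m} = u^{5^m} = (1 5^m; 0 1) ≠ 1`, contradicting `ū^{5^m} = 1`. -/
theorem not_exists_section_SL2 (m : ℕ) (hm : 1 ≤ m) :
    ¬ ∃ s : Matrix.SpecialLinearGroup (Fin 2) (ZMod (5 ^ m)) →*
        Matrix.SpecialLinearGroup (Fin 2) (ZMod (5 ^ (m + 1))),
      ∀ g, Matrix.SpecialLinearGroup.map (ZMod.castHom (pow_dvd_pow 5 m.le_succ) (ZMod (5 ^ m))) (s g) = g := by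
  rintro ⟨s, hs⟩
  haveI : NeZero (5 ^ (m + 1)) := ⟨pow_ne_zero _ (by norm_num)⟩
  haveI : NeZero (5 ^ m) := ⟨pow_ne_zero _ (by norm_num)⟩
  set R := ZMod (5 ^ (m + 1)) with hR
  set f := ZMod.castHom (pow_dvd_pow 5 m.le_succ) (ZMod (5 ^ m)) with hf
  set π : R := (5 : R) ^ m with hπ_def
  -- arithmetic of `π = 5^m` in `ℤ/5^{m+1}`
  have h0 : (5 : R) ^ (m + 1) = 0 := by exact_mod_cast ZMod.natCast_self (5 ^ (m + 1))
  have hπ2 : π * π = 0 := by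
    rw [hπ_def, ← pow_add, show m + m = (m + 1) + (m - 1) by omega, pow_add, h0, zero_mul]
  have h5π : 5 * π = 0 := by rw [hπ_def, ← pow_succ', h0]
  have hπne : π ≠ 0 := by
    rw [hπ_def, show (5 : R) ^ m = ((5 ^ m : ℕ) : R) by push_cast; rfl, Ne, ZMod.natCast_eq_zero_iff,
      Nat.pow_dvd_pow_iff_le_right (by norm_num)]
    omega
  have hπcast : ((5 ^ m : ℕ) : R) = π := by rw [hπ_def]; push_cast; rfl
  -- the transvection downstairs and its order
  let ubar : Matrix.SpecialLinearGroup (Fin 2) (ZMod (5 ^ m)) :=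
    ⟨!![1, 1; 0, 1], by simp [Matrix.det_fin_two]⟩
  have hubar_pow : ubar ^ (5 ^ m) = 1 := by
    apply Subtype.ext
    rw [Matrix.SpecialLinearGroup.coe_pow, Matrix.SpecialLinearGroup.coe_one]
    change (!![1, 1; 0, 1] : Matrix (Fin 2) (Fin 2) (ZMod (5 ^ m))) ^ (5 ^ m) = 1
    rw [transvection_pow, mul_one, ZMod.natCast_self, Matrix.one_fin_two]
  -- the lift `G = s ū` reduces to `ū`
  set G := s ubar with hG
  have hred : ∀ i j, f ((G : Matrix (Fin 2) (Fin 2) R) i j) = (ubar : Matrix (Fin 2) (Fin 2) (ZMod (5 ^ m))) i j := by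
    intro i j
    have h := congrArg (fun g : Matrix.SpecialLinearGroup (Fin 2) (ZMod (5 ^ m)) =>
      (g : Matrix (Fin 2) (Fin 2) (ZMod (5 ^ m))) i j) (hs ubar)
    simpa [Matrix.SpecialLinearGroup.map_apply_coe] using h
  -- hence `G = u + π D`
  have hker : ∀ i j, ∃ t : R, (G : Matrix (Fin 2) (Fin 2) R) i j =
      (!![1, 1; 0, 1] : Matrix (Fin 2) (Fin 2) R) i j + π * t := by
    intro i j
    have hz : f ((G : Matrix (Fin 2) (Fin 2) R) i j - (!![1, 1; 0, 1] : Matrix (Fin 2) (Fin 2) R) i j) = 0 := by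
      rw [map_sub, hred, sub_eq_zero]
      fin_cases i <;> fin_cases j <;> simp [ubar]
    obtain ⟨t, ht⟩ := exists_eq_mul_of_castHom_eq_zero m _ hz
    exact ⟨t, by rw [← sub_eq_iff_eq_add', ht, hπcast]⟩
  obtain ⟨a, ha⟩ := hker 0 0
  obtain ⟨b, hb⟩ := hker 0 1
  obtain ⟨c, hc⟩ := hker 1 0
  obtain ⟨d, hd⟩ := hker 1 1
  have hGval : (G : Matrix (Fin 2) (Fin 2) R) = !![1 + π * a, 1 + π * b; π * c, 1 + π * d] := by
    ext i j
    fin_cases i <;> fin_cases j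
    · simpa using ha
    · simpa using hb
    · simpa using hc
    · simpa using hd
  -- `G^5 = u^5`, hence `G^{5^m} = u^{5^m} = (1 π; 0 1)`
  have hG5 : ((G ^ 5 : Matrix.SpecialLinearGroup (Fin 2) R) : Matrix (Fin 2) (Fin 2) R) = !![1, 5; 0, 1] := by
    rw [Matrix.SpecialLinearGroup.coe_pow, hGval]
    exact transvection_lift_pow_five π a b c d h5π hπ2
  have h5m : 5 ^ m = 5 * 5 ^ (m - 1) := by
    rw [← pow_succ']; congr 1; omega
  have hπ' : ((5 ^ (m - 1) : ℕ) : R) * 5 = π := by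
    rw [hπ_def, Nat.cast_pow, Nat.cast_ofNat, ← pow_succ, Nat.sub_add_cancel hm]
  have hGpow : ((G ^ (5 ^ m) : Matrix.SpecialLinearGroup (Fin 2) R) : Matrix (Fin 2) (Fin 2) R) = !![1, π; 0, 1] := by
    rw [h5m, pow_mul, Matrix.SpecialLinearGroup.coe_pow, hG5, transvection_pow, hπ']
  -- but `s` is a homomorphism: `G^{5^m} = s(ū^{5^m}) = 1`
  have hone : G ^ (5 ^ m) = 1 := by rw [hG, ← map_pow, hubar_pow, map_one]
  have h01 := congrArg (fun M : Matrix.SpecialLinearGroup (Fin 2) R => (M : Matrix (Fin 2) (Fin 2) R) 0 1) hone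
  simp only [hGpow, Matrix.SpecialLinearGroup.coe_one] at h01
  exact hπne (by simpa using h01)

end nonsplit

end Summit.BirchSwinnertonDyer.BirchSwinnertonDyer.Theorems.GL2F5AdjointBricks
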